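import Mathlib
import Summits.Ventures.PercRepro2.CoinChainXASigns

/-!
# (XA′) for the general AND-switch chain under the three `y`-sign conditions
(blind cell PercRepro2, night-2 g26; proofs/NIGHT2-DARC.md §67.1)

The `x ↔ y` mirror of `chain_XA'_of_signs`: the coin, the world-0 gate and the `D′`-pivotal part
all lower the `y`-mean (`hQy`, `hP0y`, `hP'y`).  Both sides of (XA′) are symmetric in the two
markers, so the `x`-theorem with the markers swapped gives it after commuting `y W * x W`.
-/

namespace Summit.Ventures.PercRepro2.Coin

open Classical

section XASignsY

variable {V : Type*} [DecidableEq V] {R : Type*} [Field R] [LinearOrder R] [IsStrictOrderedRing R]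

/-- **(XA′) FOR THE GENERAL AND-SWITCH CHAIN UNDER THE THREE `y`-SIGN CONDITIONS** (the mirror of
`chain_XA'_of_signs`). -/
theorem chain_XA'_of_signs_y (U ent ent' : Finset V) (ν c d d' : Finset V → R)
    (hν0 : ∀ W, 0 ≤ ν W)
    (hν : ∀ s ⊆ U, ∀ t ⊆ U, ν s * ν t ≤ ν (s ∩ t) * ν (s ∪ t))
    (hc0 : ∀ W, 0 ≤ c W) (hd0 : ∀ W, 0 ≤ d W) (hd'0 : ∀ W, 0 ≤ d' W)
    (hdc : ∀ W, d W ≤ c W) (hd'c : ∀ W, d' W ≤ c W)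
    (hcc : ∀ s t, c s * c t ≤ c (s ∩ t) * c (s ∪ t))
    (hdd : ∀ s t, d s * d t ≤ d (s ∩ t) * d (s ∪ t))
    (hd'd' : ∀ s t, d' s * d' t ≤ d' (s ∩ t) * d' (s ∪ t))
    (hcd : ∀ s t, c s * d t ≤ c (s ∩ t) * d (s ∪ t))
    (hcd' : ∀ s t, c s * d' t ≤ c (s ∩ t) * d' (s ∪ t))
    (hdd' : ∀ s t, d s * d' t ≤ d (s ∩ t) * d' (s ∪ t))
    (hratio : ∀ s t, s ⊆ t → d s * c t ≤ c s * d t)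
    (hratio' : ∀ s t, s ⊆ t → d' s * c t ≤ c s * d' t)
    (x y : Finset V → R) (hx0 : ∀ W, 0 ≤ x W) (hy0 : ∀ W, 0 ≤ y W)
    (hxm : ∀ s t, x s ≤ x (s ∪ t)) (hym : ∀ s t, y s ≤ y (s ∪ t))
    (hmI : 0 < ∑ W ∈ U.powerset.filter (fun W => ¬ ∃ r ∈ ent ∪ ent', r ∈ W), ν W * c W)
    (hQy : (∑ W ∈ U.powerset, ν W * chainMix ent ent' 0 c d W) *
        (∑ W ∈ U.powerset, ν W * chainMix ent ent' 1 c d W * y W) ≤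
      (∑ W ∈ U.powerset, ν W * chainMix ent ent' 0 c d W * y W) *
        (∑ W ∈ U.powerset, ν W * chainMix ent ent' 1 c d W))
    (hP0y : (∑ W ∈ U.powerset, ν W * chainMix ent ent' 0 c d W) *
        (∑ W ∈ U.powerset, ν W * chainMix ent ent' 0 c d' W * y W) ≤
      (∑ W ∈ U.powerset, ν W * chainMix ent ent' 0 c d W * y W) *
        (∑ W ∈ U.powerset, ν W * chainMix ent ent' 0 c d' W))
    (hP'y : 0 ≤ ((∑ W ∈ U.powerset, ν W * chainMix ent ent' 0 c d W) *
          (∑ W ∈ U.powerset, ν W * chainMix ent ent' 1 c d W * y W)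
        - (∑ W ∈ U.powerset, ν W * chainMix ent ent' 0 c d W * y W) *
          (∑ W ∈ U.powerset, ν W * chainMix ent ent' 1 c d W))
      - ((∑ W ∈ U.powerset, ν W * chainMix ent ent' 0 c d W) *
          (∑ W ∈ U.powerset, ν W * chainMix ent ent' 1 c d' W * y W)
        - (∑ W ∈ U.powerset, ν W * chainMix ent ent' 0 c d W * y W) *
          (∑ W ∈ U.powerset, ν W * chainMix ent ent' 1 c d' W))
      + ((∑ W ∈ U.powerset, ν W * chainMix ent ent' 0 c d W) *
          (∑ W ∈ U.powerset, ν W * chainMix ent ent' 0 c d' W * y W)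
        - (∑ W ∈ U.powerset, ν W * chainMix ent ent' 0 c d W * y W) *
          (∑ W ∈ U.powerset, ν W * chainMix ent ent' 0 c d' W))) :
    (((∑ W ∈ U.powerset, ν W * chainMix ent ent' 0 c d W) * (∑ W ∈ U.powerset, ν W * chainMix ent ent' 1 c d W * x W) - (∑ W ∈ U.powerset, ν W * chainMix ent ent' 0 c d W * x W) * (∑ W ∈ U.powerset, ν W * chainMix ent ent' 1 c d W)) *
          ((∑ W ∈ U.powerset, ν W * chainMix ent ent' 0 c d W) * (∑ W ∈ U.powerset, ν W * chainMix ent ent' 0 c d' W * y W) - (∑ W ∈ U.powerset, ν W * chainMix ent ent' 0 c d W * y W) * (∑ W ∈ U.powerset, ν W * chainMix ent ent' 0 c d' W))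
        + ((∑ W ∈ U.powerset, ν W * chainMix ent ent' 0 c d W) * (∑ W ∈ U.powerset, ν W * chainMix ent ent' 1 c d W * y W) - (∑ W ∈ U.powerset, ν W * chainMix ent ent' 0 c d W * y W) * (∑ W ∈ U.powerset, ν W * chainMix ent ent' 1 c d W)) *
          ((∑ W ∈ U.powerset, ν W * chainMix ent ent' 0 c d W) * (∑ W ∈ U.powerset, ν W * chainMix ent ent' 0 c d' W * x W) - (∑ W ∈ U.powerset, ν W * chainMix ent ent' 0 c d W * x W) * (∑ W ∈ U.powerset, ν W * chainMix ent ent' 0 c d' W))) ≤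
        (∑ W ∈ U.powerset, ν W * chainMix ent ent' 0 c d W) * ((∑ W ∈ U.powerset, ν W * chainMix ent ent' 0 c d W) * (∑ W ∈ U.powerset, ν W * chainMix ent ent' 0 c d W) * (∑ W ∈ U.powerset, ν W * chainMix ent ent' 1 c d' W * (x W * y W))
          - (∑ W ∈ U.powerset, ν W * chainMix ent ent' 0 c d W) * (∑ W ∈ U.powerset, ν W * chainMix ent ent' 0 c d W * y W) * (∑ W ∈ U.powerset, ν W * chainMix ent ent' 1 c d' W * x W)
          - (∑ W ∈ U.powerset, ν W * chainMix ent ent' 0 c d W) * (∑ W ∈ U.powerset, ν W * chainMix ent ent' 0 c d W * x W) * (∑ W ∈ U.powerset, ν W * chainMix ent ent' 1 c d' W * y W)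
          + (∑ W ∈ U.powerset, ν W * chainMix ent ent' 0 c d W * x W) * (∑ W ∈ U.powerset, ν W * chainMix ent ent' 0 c d W * y W) * (∑ W ∈ U.powerset, ν W * chainMix ent ent' 1 c d' W)) := by
  have h := chain_XA'_of_signs U ent ent' ν c d d' hν0 hν hc0 hd0 hd'0 hdc hd'c hcc hdd hd'd' hcd
    hcd' hdd' hratio hratio' y x hy0 hx0 hym hxm hmI hQy hP0y hP'y
  have e : (∑ W ∈ U.powerset, ν W * chainMix ent ent' 1 c d' W * (y W * x W)) =
      ∑ W ∈ U.powerset, ν W * chainMix ent ent' 1 c d' W * (x W * y W) :=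
    Finset.sum_congr rfl fun W _ => by rw [mul_comm (y W)]
  rw [e] at h
  linarith [h]

/-- **THE GENERAL AND-SWITCH CHAIN AT EVERY COIN PROBABILITY UNDER THE THREE `y`-SIGN
CONDITIONS** (`chain_functional_nonneg_of_XA'` with `hXA'` discharged by `chain_XA'_of_signs_y`). -/
theorem chain_functional_nonneg_of_signs_y (U ent ent' : Finset V) (ν c d d' : Finset V → R)
    (ρ : R) (hρ0 : 0 ≤ ρ) (hρ1 : ρ ≤ 1) (hν0 : ∀ W, 0 ≤ ν W)
    (hν : ∀ s ⊆ U, ∀ t ⊆ U, ν s * ν t ≤ ν (s ∩ t) * ν (s ∪ t))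
    (hc0 : ∀ W, 0 ≤ c W) (hd0 : ∀ W, 0 ≤ d W) (hd'0 : ∀ W, 0 ≤ d' W)
    (hdc : ∀ W, d W ≤ c W) (hd'c : ∀ W, d' W ≤ c W) (hd'd : ∀ W, d' W ≤ d W)
    (hcc : ∀ s t, c s * c t ≤ c (s ∩ t) * c (s ∪ t))
    (hdd : ∀ s t, d s * d t ≤ d (s ∩ t) * d (s ∪ t))
    (hd'd' : ∀ s t, d' s * d' t ≤ d' (s ∩ t) * d' (s ∪ t))
    (hcd : ∀ s t, c s * d t ≤ c (s ∩ t) * d (s ∪ t))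
    (hcd' : ∀ s t, c s * d' t ≤ c (s ∩ t) * d' (s ∪ t))
    (hdd' : ∀ s t, d s * d' t ≤ d (s ∩ t) * d' (s ∪ t))
    (hratio : ∀ s t, s ⊆ t → d s * c t ≤ c s * d t)
    (hratio' : ∀ s t, s ⊆ t → d' s * c t ≤ c s * d' t)
    (x y : Finset V → R) (hx0 : ∀ W, 0 ≤ x W) (hy0 : ∀ W, 0 ≤ y W)
    (hxm : ∀ s t, x s ≤ x (s ∪ t)) (hym : ∀ s t, y s ≤ y (s ∪ t))
    (hpos0 : 0 < ∑ W ∈ U.powerset, ν W * chainMix ent ent' 0 c d W)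
    (hpos1 : 0 < ∑ W ∈ U.powerset, ν W * chainMix ent ent' 1 c d W)
    (hmI : 0 < ∑ W ∈ U.powerset.filter (fun W => ¬ ∃ r ∈ ent ∪ ent', r ∈ W), ν W * c W)
    (hQy : (∑ W ∈ U.powerset, ν W * chainMix ent ent' 0 c d W) *
        (∑ W ∈ U.powerset, ν W * chainMix ent ent' 1 c d W * y W) ≤
      (∑ W ∈ U.powerset, ν W * chainMix ent ent' 0 c d W * y W) *
        (∑ W ∈ U.powerset, ν W * chainMix ent ent' 1 c d W))
    (hP0y : (∑ W ∈ U.powerset, ν W * chainMix ent ent' 0 c d W) *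
        (∑ W ∈ U.powerset, ν W * chainMix ent ent' 0 c d' W * y W) ≤
      (∑ W ∈ U.powerset, ν W * chainMix ent ent' 0 c d W * y W) *
        (∑ W ∈ U.powerset, ν W * chainMix ent ent' 0 c d' W))
    (hP'y : 0 ≤ ((∑ W ∈ U.powerset, ν W * chainMix ent ent' 0 c d W) *
          (∑ W ∈ U.powerset, ν W * chainMix ent ent' 1 c d W * y W)
        - (∑ W ∈ U.powerset, ν W * chainMix ent ent' 0 c d W * y W) *
          (∑ W ∈ U.powerset, ν W * chainMix ent ent' 1 c d W))
      - ((∑ W ∈ U.powerset, ν W * chainMix ent ent' 0 c d W) *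
          (∑ W ∈ U.powerset, ν W * chainMix ent ent' 1 c d' W * y W)
        - (∑ W ∈ U.powerset, ν W * chainMix ent ent' 0 c d W * y W) *
          (∑ W ∈ U.powerset, ν W * chainMix ent ent' 1 c d' W))
      + ((∑ W ∈ U.powerset, ν W * chainMix ent ent' 0 c d W) *
          (∑ W ∈ U.powerset, ν W * chainMix ent ent' 0 c d' W * y W)
        - (∑ W ∈ U.powerset, ν W * chainMix ent ent' 0 c d W * y W) *
          (∑ W ∈ U.powerset, ν W * chainMix ent ent' 0 c d' W))) :
    0 ≤ (∑ W ∈ U.powerset, ν W * chainMix ent ent' ρ c d W) ^ 2 *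
          (∑ W ∈ U.powerset, ν W * chainMix ent ent' ρ c d' W * (x W * y W))
        - (∑ W ∈ U.powerset, ν W * chainMix ent ent' ρ c d W) *
          (∑ W ∈ U.powerset, ν W * chainMix ent ent' ρ c d W * x W) *
          (∑ W ∈ U.powerset, ν W * chainMix ent ent' ρ c d' W * y W)
        - (∑ W ∈ U.powerset, ν W * chainMix ent ent' ρ c d W) *
          (∑ W ∈ U.powerset, ν W * chainMix ent ent' ρ c d W * y W) *
          (∑ W ∈ U.powerset, ν W * chainMix ent ent' ρ c d' W * x W)
        + (∑ W ∈ U.powerset, ν W * chainMix ent ent' ρ c d W * x W) *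
          (∑ W ∈ U.powerset, ν W * chainMix ent ent' ρ c d W * y W) *
          (∑ W ∈ U.powerset, ν W * chainMix ent ent' ρ c d' W) :=
  chain_functional_nonneg_of_XA' U ent ent' ν c d d' ρ hρ0 hρ1 hν0 hν hc0 hd0 hd'0 hdc hd'c hd'd
    hcc hdd hd'd' hcd hcd' hdd' hratio hratio' x y hx0 hy0 hxm hym hpos0 hpos1 hmI
    (chain_XA'_of_signs_y U ent ent' ν c d d' hν0 hν hc0 hd0 hd'0 hdc hd'c hcc hdd hd'd' hcd hcd'
      hdd' hratio hratio' x y hx0 hy0 hxm hym hmI hQy hP0y hP'y)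

end XASignsY

end Summit.Ventures.PercRepro2.Coin
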